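import Mathlib
import Summits.ResolutionOfSingularities.ResolutionOfSingularities.Theorems.WeightedInvariantDatumToEmbeddedAtlasDefs
import Summits.ResolutionOfSingularities.ResolutionOfSingularities.Theorems.WeightedInvariantDatumToEmbeddedStrictTransformCharts
import Literature.AlgebraicGeometry.Resolution.CobordantBlowupGlobal
import Literature.AlgebraicGeometry.Resolution.BlowupPrincipalCharts
import Literature.AlgebraicGeometry.Resolution.StrictNormalCrossingsFibre
import HarnessLib

/-!
# The quotient chart under an ambient chart, I: local lemmas

Topic: `Summits/ResolutionOfSingularities/ResolutionOfSingularities/Theorems`. Helper file of the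
stub `stub_qs_atlas_quotient` of the line `Sketch` of the crux
`Theses.WeightedInvariant.DatumToEmbedded` (statement `stmt-ResolutionOfSingularities-0572`) of
the summit `Summit.ResolutionOfSingularities.ResolutionOfSingularities`.

Setting (J. Włodarczyk, arXiv:2203.03090, §2.3.3: the quotient of the cobordant blow-up `B₊` by
the torus is the blow-up of the quotient downstairs; Stacks 0804: the charts `Spec A[I/g]` of a
blowing up). The stub compares, on the integral strict transform `X' ⊆ B₊ = R'.plus`, the preimage
of an ambient chart `D(β t^{Dg}) ⊆ B₊` with the preimage of the principal chart `V'[U, b]` of the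
blow-up `ρ : V' ⟶ V` downstairs (`blowupChart`, `Literature/…/BlowupPrincipalCharts.lean`). This
file collects the local ingredients, all folklore glue on Mathlib and the tree:

* `apply_mem_basicOpen_of_isUnit` — if `f♯r|_V` is a unit then `f(V) ⊆ D(r)` ("a unit at a
  point of the source is a unit near the image point", open form);
* (two generators of a principal ideal of a domain differ by a unit: the tree's
  `exists_isUnit_mul_eq_of_span_singleton_eq`, `Literature/…/StrictNormalCrossingsFibre.lean`);
* `isPrincipalChart_basicOpen_of_eq_mul` — if on a principal chart `W` for `(U, g)` one has
  `ρ♯b = c · ρ♯g`, then `D(c) ⊆ W` is a principal chart for `(U, b)`;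
  `ideal_comap_comap_of_isPrincipalChart` — the principal-chart identity pulled back along a
  morphism `q' : T ⟶ V'`;
* `excPlus_pow_ideal` — on an affine open `O` of `B₊`, `(t⁻¹)^n · 𝒪(O) = (tInvOn R' O ^ n)`;
  `appLE_tInvOn`, `comap_excPlus_pow_ideal`, `appLE_tInvOn_top_ne_zero` — along any
  `i' : T ⟶ B₊`: `i'♯(t⁻¹|_O) = i'♯(t⁻¹)|_{O''}`, `((t⁻¹)^n · 𝒪_T)(O'') = (i'♯(t⁻¹)|_{O''} ^ n)`, and
  `i'♯(t⁻¹)|_{O''} ≠ 0` on a non-empty open of an INTEGRAL `T` on which `t⁻¹` is not identically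
  zero (irreducibility), as in `Lift.isEffectiveCartier_comap_pow`;
* `stub_qs_atlasQuotientLocal` — the registered form (the generator change).
-/

noncomputable section

open CategoryTheory CategoryTheory.Limits AlgebraicGeometry TopologicalSpace
open Literature.AlgebraicGeometry.Resolution

set_option linter.dupNamespace false -- mandated namespace `…Theorems.DatumToEmbedded.<Topic>`

namespace Summit.ResolutionOfSingularities.ResolutionOfSingularities.Theorems.DatumToEmbedded.AtlasQuotient

universe u

/-! ## Units and generators -/

section Generic

/-- **A unit on the source is a unit near the image**: if the pull-back `f♯r|_V` of a section
`r ∈ Γ(Y, U)` to an open `V ⊆ f⁻¹U` is a unit, then `f` maps `V` into the basic open `D(r)`.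
[folklore] -/
theorem apply_mem_basicOpen_of_isUnit {X Y : Scheme.{u}} (f : X ⟶ Y) {U : Y.Opens} {V : X.Opens}
    (h : V ≤ f ⁻¹ᵁ U) {r : Γ(Y, U)} (hu : IsUnit (f.appLE U V h r)) {x : X} (hx : x ∈ V) :
    f x ∈ Y.basicOpen r := by
  have hx' : x ∈ X.basicOpen (f.appLE U V h r) := by rwa [X.basicOpen_of_isUnit hu]
  rw [Scheme.basicOpen_appLE] at hx'
  exact hx'.2

end Generic

/-! ## Principal charts: shrinking to a basic open, pulling back -/

section Principal

variable {X' X : Scheme.{u}} {π : X' ⟶ X} {I : X.IdealSheafData} {U : X.affineOpens}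
  {g b : Γ(X, U)} {W : X'.affineOpens}

/-- **Changing the generator on a basic open.** If `W` is a principal chart of `π` for `(U, g)`
and `π♯b = c · π♯g` on `W`, then the basic open `D(c) ⊆ W` is a principal chart for `(U, b)`:
there `π♯b = (unit) · π♯g` is again a regular generator of `I · 𝒪_{X'}`. [folklore] -/
theorem isPrincipalChart_basicOpen_of_eq_mul (hW : IsPrincipalChart π I U g W) (c : Γ(X', W))
    (hc : π.appLE U W hW.le_preimage b = c * π.appLE U W hW.le_preimage g) :
    IsPrincipalChart π I U b ⟨X'.basicOpen c, W.2.basicOpen c⟩ := by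
  have hle : X'.basicOpen c ≤ (W : X'.Opens) := X'.basicOpen_le c
  obtain ⟨h, hnzd, hideal⟩ := hW.of_le (W' := ⟨X'.basicOpen c, W.2.basicOpen c⟩) hle
  have hu : IsUnit (X'.presheaf.map (homOfLE hle).op c) := X'.toRingedSpace.isUnit_res_basicOpen c
  have hb' : π.appLE U (X'.basicOpen c) h b =
      X'.presheaf.map (homOfLE hle).op c * π.appLE U (X'.basicOpen c) h g := by
    rw [← map_appLE_eq hW.le_preimage hle b, hc, map_mul, map_appLE_eq]
  refine ⟨h, ?_, ?_⟩
  · rw [hb']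
    exact mul_mem hu.mem_nonZeroDivisors hnzd
  · rw [hb', Ideal.span_singleton_mul_left_unit hu, hideal]

/-- **The principal-chart identity pulled back**: along any `q' : T ⟶ X'` mapping the affine
open `O'' ⊆ T` into the principal chart `W` for `(U, g)`, the ideal sheaf `(I · 𝒪_{X'}) · 𝒪_T`
is generated on `O''` by `q'♯ π♯ g`. [folklore] -/
theorem ideal_comap_comap_of_isPrincipalChart (hW : IsPrincipalChart π I U g W) {T : Scheme.{u}}
    (q' : T ⟶ X') (O'' : T.affineOpens) (hO'' : (O'' : T.Opens) ≤ q' ⁻¹ᵁ (W : X'.Opens)) :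
    ((I.comap π).comap q').ideal O'' =
      Ideal.span {q'.appLE W O'' hO'' (π.appLE U W hW.le_preimage g)} := by
  obtain ⟨h, -, hideal⟩ := id hW
  rw [ideal_comap_of_le q' (I.comap π) W O'' hO'', hideal, Ideal.map_span, Set.image_singleton]

end Principal

/-! ## The exceptional ideal `(t⁻¹)` on `B₊` and along morphisms to `B₊` -/

section Exceptional

variable {Y : Scheme.{0}} (R' : ReesFiltration Y)

/-- On an affine open `O` of `B₊`, the exceptional ideal sheaf `(t⁻¹)` is generated by
`tInvOn R' O`. [cite: Wlodarczyk2022, Lemma 2.3.8] -/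
theorem excPlus_ideal (O : (R'.plus : Scheme.{0}).affineOpens) :
    R'.excPlus.ideal O = Ideal.span {tInvOn R' O} := by
  rw [ReesFiltration.excPlus, ReesFiltration.exc, ← Scheme.IdealSheafData.comap_comp]
  exact StrictTransform.comap_idealSheaf_X_ideal (R'.plus.ι ≫ R'.toA1) O

/-- On an affine open `O` of `B₊`, `(t⁻¹)ⁿ · 𝒪(O) = (tInvOn R' O ^ n)`. [folklore] -/
theorem excPlus_pow_ideal (O : (R'.plus : Scheme.{0}).affineOpens) (n : ℕ) :
    (R'.excPlus ^ n).ideal O = Ideal.span {tInvOn R' O ^ n} := by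
  rw [Scheme.IdealSheafData.ideal_pow, Pi.pow_apply, excPlus_ideal, Ideal.span_singleton_pow]

variable {T : Scheme.{0}} (i' : T ⟶ (R'.plus : Scheme.{0}))

/-- Pulling back `t⁻¹|_O` along `i' : T ⟶ B₊` to `O'' ⊆ i'⁻¹O` gives the restriction to `O''` of
the pull-back of the global `t⁻¹`. [folklore] -/
theorem appLE_tInvOn {O : (R'.plus : Scheme.{0}).Opens} {O'' : T.Opens} (h : O'' ≤ i' ⁻¹ᵁ O) :
    i'.appLE O O'' h (tInvOn R' O) = i'.appLE ⊤ O'' le_top (tInvOn R' ⊤) := by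
  rw [← stub_qs_tInvOn_map R' (le_top : O ≤ ⊤), ← CommRingCat.comp_apply, Scheme.Hom.map_appLE]

/-- The pull-back of the global `t⁻¹` is the pull-back of the coordinate `x` of `𝔸¹ = Spec ℤ[x]`
along `T ⟶ B₊ ⟶ B ⟶ 𝔸¹`. [folklore] -/
theorem appLE_tInvOn_top_eq (O'' : T.Opens) :
    i'.appLE ⊤ O'' le_top (tInvOn R' ⊤) = (i' ≫ R'.plus.ι ≫ R'.toA1).appLE ⊤ O'' le_top
      ((Scheme.ΓSpecIso (CommRingCat.of (Polynomial ReesFiltration.ZZ.{0}))).inv Polynomial.X) := by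
  rw [tInvOn, ← CommRingCat.comp_apply, Scheme.Hom.appLE_comp_appLE]

/-- Along `i' : T ⟶ B₊`, the exceptional ideal sheaf pulls back to the ideal sheaf generated on
every affine open `O''` by `i'♯(t⁻¹)|_{O''}`. [folklore] -/
theorem comap_excPlus_ideal (O'' : T.affineOpens) :
    (R'.excPlus.comap i').ideal O'' = Ideal.span {i'.appLE ⊤ O'' le_top (tInvOn R' ⊤)} := by
  have hE : R'.excPlus.comap i' = (affineBlowup.idealSheaf
      (Ideal.span {(Polynomial.X : Polynomial ReesFiltration.ZZ.{0})})).comap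
        (i' ≫ R'.plus.ι ≫ R'.toA1) := by
    rw [Scheme.IdealSheafData.comap_comp, Scheme.IdealSheafData.comap_comp]
    rfl
  rw [hE, StrictTransform.comap_idealSheaf_X_ideal, appLE_tInvOn_top_eq]

/-- … and its powers to the ideals generated by the powers. [folklore] -/
theorem comap_excPlus_pow_ideal (O'' : T.affineOpens) (n : ℕ) :
    ((R'.excPlus.comap i') ^ n).ideal O'' = Ideal.span {i'.appLE ⊤ O'' le_top (tInvOn R' ⊤) ^ n} := by
  rw [Scheme.IdealSheafData.ideal_pow, Pi.pow_apply, comap_excPlus_ideal, Ideal.span_singleton_pow]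

/-- **`t⁻¹` does not vanish identically on any non-empty open of an integral `T` on which it is
not identically zero**: if `T` is integral and the preimage of `𝔸¹ ∖ 0` under
`T ⟶ B₊ ⟶ B ⟶ 𝔸¹` is non-empty, then `i'♯(t⁻¹)|_{O''} ≠ 0` for every non-empty open `O''` (its
non-vanishing locus `O'' ∩ {t⁻¹ ≠ 0}` is a non-empty open, by irreducibility). [folklore] -/
theorem appLE_tInvOn_top_ne_zero [IsIntegral T]
    (hτ : (((i' ≫ R'.plus.ι ≫ R'.toA1) ⁻¹ᵁ
      PrimeSpectrum.basicOpen (Polynomial.X : Polynomial ReesFiltration.ZZ.{0}) : T.Opens) :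
        Set T).Nonempty)
    (O'' : T.Opens) (hO'' : (O'' : Set T).Nonempty) :
    i'.appLE ⊤ O'' le_top (tInvOn R' ⊤) ≠ 0 := by
  rw [appLE_tInvOn_top_eq]
  intro h0
  have hbo : T.basicOpen ((i' ≫ R'.plus.ι ≫ R'.toA1).appLE ⊤ O'' le_top
      ((Scheme.ΓSpecIso (CommRingCat.of (Polynomial ReesFiltration.ZZ.{0}))).inv
        Polynomial.X)) = ⊥ := by
    rw [h0, Scheme.basicOpen_zero]
  rw [Scheme.basicOpen_appLE, basicOpen_eq_of_affine] at hbo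
  have hne := nonempty_preirreducible_inter O''.isOpen
    ((i' ≫ R'.plus.ι ≫ R'.toA1) ⁻¹ᵁ
      PrimeSpectrum.basicOpen (Polynomial.X : Polynomial ReesFiltration.ZZ.{0})).isOpen hO'' hτ
  rw [← Opens.coe_inf, hbo, Opens.coe_bot] at hne
  exact Set.not_nonempty_empty hne

end Exceptional

/-! ## Registered form -/

/-- **Registered sub-goal `stub_qs_atlasQuotientLocal`** of the crux (helper of the stub
`stub_qs_atlas_quotient`): changing the generator of a principal chart on a basic open — if `W`
is a principal chart for `(U, g)` and `π♯b = c · π♯g` on `W`, then `D(c)` is a principal chart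
for `(U, b)`. [folklore] -/
theorem stub_qs_atlasQuotientLocal :
    ∀ {X' X : Scheme.{0}} {π : X' ⟶ X} {I : X.IdealSheafData} {U : X.affineOpens}
      {g b : Γ(X, U)} {W : X'.affineOpens}
      (hW : Literature.AlgebraicGeometry.Resolution.IsPrincipalChart π I U g W) (c : Γ(X', W)),
      π.appLE U W hW.le_preimage b = c * π.appLE U W hW.le_preimage g →
      Literature.AlgebraicGeometry.Resolution.IsPrincipalChart π I U b
        ⟨X'.basicOpen c, W.2.basicOpen c⟩ :=
  fun hW c hc => isPrincipalChart_basicOpen_of_eq_mul hW c hc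

end Summit.ResolutionOfSingularities.ResolutionOfSingularities.Theorems.DatumToEmbedded.AtlasQuotient

end
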